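import Literature.NumberTheory.EllipticCurves.FormalGroupKummerPointProofs
import Literature.NumberTheory.EllipticCurves.IwasawaSelmerControlLocalInputsProofs
import HarnessLib

/-!
# The valuation on the fixed field of a layer subgroup `H_{v,n} ≤ Γ_{K_v}`: a uniform bound below
# `1` by the norm to the inertia-fixed field (input `ρ` of the rank-`d` Kummer points)

`Proofs` file (theorems only: **no definition, no named fact, nothing asserted**) in topic
`NumberTheory/EllipticCurves`, sequel of `FormalGroupKummerPointProofs` /
`FormalGroupKummerPointsRankProofs`. The `d` Kummer points of
`IsDedekindDomain.HeightOneSpectrum.exists_kummerPoints_rank` (input (C2_d) of the rank-`d`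
local skeleton of Greenberg's Lemma 3.4 at the layers `n ≥ 1`, R. Greenberg, *Iwasawa theory for
elliptic curves*, LNM 1716 (1999), §3 Lemma 3.4, p. 89) need a UNIFORM BOUND `ρ < 1` for `|x|_v`
over the elements `x ∈ K̄_v` with `|x|_v < 1` fixed by the subgroup `H` — the discreteness of the
valuation of the fixed field of `H`, which the tree cannot phrase through a completed layer field.
**This file proves that bound for the local layer subgroups `H_{v,n}` of any `ℤ_p`-extension**,
elementarily:

* `spectralValuation_pow_le_of_forall_smul_eq` — **norm to the base**: if `H ⊴ Γ_{K_v}`,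
  `σ₀ ∈ Γ_{K_v}` with `σ₀^N ∈ H` (`N ≥ 1`) and `Γ_{K_v} = ⋃_{a} σ₀^a H`, then for `x` fixed by `H`
  the product `y = ∏_{j mod N} σ₀^j x` is fixed by ALL of `Γ_{K_v}`, in particular by the inertia
  group, so (`spectralValuation_le_of_forall_inertia`, `K_v` absolutely unramified: `p` a
  uniformiser) `|x|^N = |y| ≤ |p|` as soon as `|x| < 1`.
* `ZpExtension.exists_generator_cosets_localSubgroup` — **`Γ_{K_v}/H_{v,n}` is cyclic of order
  dividing `pⁿ`**: for a `ℤ_p`-extension `κ` of `K` and every `n` there are `σ₀ ∈ Γ_{K_v}` and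
  `N ∣ pⁿ` with `σ₀^N ∈ H_{v,n} = (Γ_{K_v} → Γ_K)⁻¹(κ⁻¹(pⁿℤ_p))` and every `τ ∈ Γ_{K_v}` of the form
  `σ₀^a h`, `h ∈ H_{v,n}` (the local character `λ = κ ∘ res` has image `p^{m}ℤ_p` or `0`; take
  `σ₀` of minimal valuation and `a = ` the `p^{n-m}`-digit approximation of `λ(τ)/λ(σ₀)`,
  `PadicInt.appr`), cf. the tree's `ZpExtension.exists_mem_localSubgroup_generate` (Greenberg, §3
  p. 87: "`Γ_{v_n}` … topologically generated by `γ_{v_n}`").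
* `spectralValuation_le_of_forall_mem_localSubgroup_smul_eq` — **the bound**: for `v ∣ p`
  absolutely unramified, `x ∈ K̄_v` fixed by `H_{v,n}` with `|x| < 1`, and any `π` with
  `|π|^d = |p|`, `pⁿ ∣ d`: `|x| ≤ |π|` (`|x|^d ≤ |x|^N ≤ |p| = |π|^d`). For the cyclotomic tower over
  `ℚ` and `π` a uniformiser of `(ℚ_n)_p` (`d = pⁿ`) this is "`|·|` on `(ℚ_n)_p` takes no value in
  `(|π|, 1)`".

HONEST FRAMING (cell `bsd-f1-sign2`, WIDTH-5 attach seat `bsd-line-att-p5` g41 on crux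
stmt-BirchSwinnertonDyer-22298, lineage successor (i) "Lemma 3.4 at `n = 1`, `p = 2`"): local
bookkeeping feeding `ρ` of `exists_kummerPoints_rank`; closes no item; BSD is not proved by any of this.

## References

* [NeukirchANT1999] J. Neukirch, *Algebraic Number Theory* (1999), Ch. II (7.5), (9.11) (value group
  of the maximal unramified extension).
* [GreenbergLNM1716] R. Greenberg, LNM 1716 (1999), §3 p. 87 (the local layer groups), Lemma 3.4.
* [Washington1997] L. C. Washington, *Introduction to Cyclotomic Fields*, §13.1 (layers of a
  `ℤ_p`-extension).

## Design

No definitions, no named facts; `noncomputable section`; one universe `u`; fixedness by a subgroup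
is phrased `∀ σ ∈ H, σ • x = x`; the finite product is indexed by `ZMod N` so that the coset shift
is the bijection `j ↦ j + a`. Axioms: `propext`, `Classical.choice`, `Quot.sound`.
-/

noncomputable section

open scoped Classical NNReal
open NumberField IsDedekindDomain

universe u

/-! ## §1 The norm to the base of an `H`-fixed element -/

namespace IsDedekindDomain.HeightOneSpectrum

open Literature.NumberTheory.EllipticCurves Literature.NumberTheory.GaloisRepresentations Field

variable {K : Type u} [Field K] [NumberField K] {v : HeightOneSpectrum (𝓞 K)}
  {p : ℕ} [hp : Fact p.Prime] (hpv : (p : 𝓞 K) ∈ v.asIdeal)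
  {w : Valuation (AlgebraicClosure (v.adicCompletion K)) ℝ≥0}
  (hw : ∀ x, (w x : ℝ) = spectralNorm (v.adicCompletion K) (AlgebraicClosure (v.adicCompletion K)) x)

/-- Powers of `σ₀` act on an `H`-fixed element only through the exponent modulo `N`, when
`σ₀^N ∈ H`. [folklore] -/
private theorem pow_smul_eq_pow_mod_smul {H : Subgroup (absoluteGaloisGroup (v.adicCompletion K))}
    {σ₀ : absoluteGaloisGroup (v.adicCompletion K)} {N : ℕ} (hσN : σ₀ ^ N ∈ H)
    {x : AlgebraicClosure (v.adicCompletion K)} (hx : ∀ σ ∈ H, σ • x = x) (m : ℕ) :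
    σ₀ ^ m • x = σ₀ ^ (m % N) • x := by
  conv_lhs => rw [← Nat.mod_add_div m N, pow_add, pow_mul, mul_smul, hx _ (H.pow_mem hσN _)]

omit hp in
include hw in
/-- **Norm to the base: `|x|^N ≤ |p|` for an `H`-fixed `x` with `|x| < 1`.** Let `v ∣ p` with `p`
a uniformiser of `K_v`, `H ⊴ Γ_{K_v}`, `σ₀ ∈ Γ_{K_v}` and `N ≥ 1` with `σ₀^N ∈ H` and every
`τ ∈ Γ_{K_v}` of the form `σ₀^a h` (`h ∈ H`). If `x ∈ K̄_v` is fixed by `H` and `|x|_v < 1` then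
`|x|_v^N ≤ |p|_v`: the product `y = ∏_{j mod N} σ₀^j x` is fixed by every `τ = σ₀^a h`
(`τ σ₀^j x = σ₀^{a+j} (σ₀^{-j} … ) x = σ₀^{a+j} x`, `H` normal, and `j ↦ j + a` permutes `ℤ/N`), in
particular by the inertia group, so `|y| = |x|^N < 1` forces `|y| ≤ |p|`
(`spectralValuation_le_of_forall_inertia`: the value group of `K_v^{nr}` is `|p|^ℤ`).
[cite: NeukirchANT1999, Ch. II Prop. (7.5) with Prop. (9.11)] -/
theorem spectralValuation_pow_le_of_forall_smul_eq {𝔐 : Ideal (localAbsIntegers v)}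
    (h𝔐 : 𝔐 ∈ v.localPrimesAbove) (hϖ : Irreducible ((p : ℕ) : v.adicCompletionIntegers K))
    (H : Subgroup (absoluteGaloisGroup (v.adicCompletion K))) [hH : H.Normal]
    {σ₀ : absoluteGaloisGroup (v.adicCompletion K)} {N : ℕ} (hN : 0 < N) (hσN : σ₀ ^ N ∈ H)
    (hcos : ∀ τ : absoluteGaloisGroup (v.adicCompletion K), ∃ (a : ℕ) (h : absoluteGaloisGroup
      (v.adicCompletion K)), h ∈ H ∧ τ = σ₀ ^ a * h)
    {x : AlgebraicClosure (v.adicCompletion K)} (hx : ∀ σ ∈ H, σ • x = x) (hx1 : w x < 1) :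
    w x ^ N ≤ w (p : AlgebraicClosure (v.adicCompletion K)) := by
  haveI : NeZero N := ⟨hN.ne'⟩
  -- the norm `y`
  let y : AlgebraicClosure (v.adicCompletion K) := ∏ j : ZMod N, σ₀ ^ (j.val) • x
  -- `τ • (σ₀^j • x) = σ₀^{a + j} • x` for `τ = σ₀^a h`
  have hmove : ∀ (a j : ℕ) (h : absoluteGaloisGroup (v.adicCompletion K)), h ∈ H →
      (σ₀ ^ a * h) • (σ₀ ^ j • x) = σ₀ ^ ((a + j) % N) • x := by
    intro a j h hh
    have hconj : (σ₀ ^ j)⁻¹ * h * σ₀ ^ j ∈ H := by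
      have := hH.conj_mem h hh (σ₀ ^ j)⁻¹
      rwa [inv_inv] at this
    calc (σ₀ ^ a * h) • (σ₀ ^ j • x)
        = (σ₀ ^ a * σ₀ ^ j) • (((σ₀ ^ j)⁻¹ * h * σ₀ ^ j) • x) := by
          rw [← mul_smul, ← mul_smul]; congr 1; group
      _ = σ₀ ^ (a + j) • x := by rw [hx _ hconj, pow_add]
      _ = σ₀ ^ ((a + j) % N) • x := pow_smul_eq_pow_mod_smul hσN hx _
  -- `y` is fixed by every `τ`
  have hy : ∀ τ : absoluteGaloisGroup (v.adicCompletion K), τ • y = y := by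
    intro τ
    obtain ⟨a, h, hh, rfl⟩ := hcos τ
    change (σ₀ ^ a * h) • (∏ j : ZMod N, σ₀ ^ (j.val) • x) = ∏ j : ZMod N, σ₀ ^ (j.val) • x
    rw [Finset.smul_prod']
    calc ∏ j : ZMod N, (σ₀ ^ a * h) • (σ₀ ^ (j.val) • x)
        = ∏ j : ZMod N, σ₀ ^ ((j + (a : ZMod N)).val) • x := by
          refine Finset.prod_congr rfl fun j _ ↦ ?_
          rw [hmove a j.val h hh, ZMod.val_add, ZMod.val_natCast, add_comm, Nat.add_mod_mod]
      _ = ∏ j : ZMod N, σ₀ ^ (j.val) • x :=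
          Fintype.prod_equiv (Equiv.addRight (a : ZMod N)) _ _ fun _ ↦ rfl
  -- hence by the inertia group: `|y| ≤ |p|`
  have hyval : w y = w x ^ N := by
    change w (∏ j : ZMod N, σ₀ ^ (j.val) • x) = w x ^ N
    rw [map_prod, Finset.prod_congr rfl fun j _ ↦ spectralValuation_smul hw (σ₀ ^ (j.val)) x,
      Finset.prod_const, Finset.card_univ, ZMod.card]
  have hy1 : w y < 1 := by rw [hyval]; exact pow_lt_one₀ zero_le hx1 hN.ne'
  have hyI : ∀ σ ∈ 𝔐.inertia (absoluteGaloisGroup (v.adicCompletion K)),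
      absoluteGaloisGroup.toAlgEquiv (v.adicCompletion K) σ y = y := fun σ _ ↦ hy σ
  have h := spectralValuation_le_of_forall_inertia hw h𝔐 hϖ hyI hy1
  rwa [hyval, SubringClass.coe_natCast, map_natCast] at h

end IsDedekindDomain.HeightOneSpectrum

/-! ## §2 `Γ_{K_v}/H_{v,n}` is cyclic of order dividing `pⁿ` -/

namespace Literature.NumberTheory.EllipticCurves

open Field

variable {K : Type u} [Field K] {p : ℕ} [hp : Fact p.Prime] (κ : ZpExtension K p)
  (E : Type u) [Field E] [Algebra K E]

/-- **The local layer quotient `Γ_E/H_{E,n}` is cyclic of order dividing `pⁿ`.** For a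
`ℤ_p`-extension `κ` of `K`, a `K`-field `E` (a completion `K_v`) and every `n` there are
`σ₀ ∈ Γ_E` and `N ∣ pⁿ`, `N ≥ 1`, with `σ₀^N ∈ H_{E,n} = (Γ_E → Γ_K)⁻¹(κ⁻¹(pⁿℤ_p))` and every
`τ ∈ Γ_E` of the form `σ₀^a h` with `a < N`, `h ∈ H_{E,n}`. Proof: with `λ = κ ∘ (Γ_E → Γ_K)`
(additively), if `λ(Γ_E) ⊆ pⁿℤ_p` take `σ₀ = 1`, `N = 1`; otherwise let `σ₀` have `λ(σ₀) = u p^m` of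
minimal valuation `m < n`, `N = p^{n-m}`; for `τ ∈ Γ_E`, `λ(τ) = p^m z` and with `a < p^{n-m}` the
approximation of `z u⁻¹` modulo `p^{n-m}` (`PadicInt.appr`) one gets `λ(σ₀^{-a} τ) ∈ pⁿℤ_p`. This is
the finite-level form of the tree's `ZpExtension.exists_mem_localSubgroup_generate` (Greenberg,
LNM 1716, §3 p. 87: `Gal((F_∞)_η/(F_n)_{v_n})` procyclic; Washington §13.1).
[cite: GreenbergLNM1716, §3 Lemma 3.3 (proof, p. 87)] -/
theorem ZpExtension.exists_generator_cosets_localSubgroup (n : ℕ) :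
    ∃ (σ₀ : absoluteGaloisGroup E) (N : ℕ), 0 < N ∧ N ∣ p ^ n ∧
      σ₀ ^ N ∈ localSubgroup (κ.layerSubgroup n) E ∧
      ∀ τ : absoluteGaloisGroup E, ∃ (a : ℕ) (h : absoluteGaloisGroup E),
        a < N ∧ h ∈ localSubgroup (κ.layerSubgroup n) E ∧ τ = σ₀ ^ a * h := by
  set Hn : Subgroup (absoluteGaloisGroup E) := localSubgroup (κ.layerSubgroup n) E with hHn
  -- the local character, additively
  let lam : absoluteGaloisGroup E → ℤ_[p] := fun x ↦ (κ (resGal (K := K) E x)).toAdd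
  have hlam_mul : ∀ x y : absoluteGaloisGroup E, lam (x * y) = lam x + lam y := fun x y ↦ by
    show (κ (resGal (K := K) E (x * y))).toAdd = _
    rw [map_mul, map_mul, toAdd_mul]
  have hlam_pow : ∀ (x : absoluteGaloisGroup E) (k : ℕ), lam (x ^ k) = k • lam x := fun x k ↦ by
    show (κ (resGal (K := K) E (x ^ k))).toAdd = k • (κ (resGal (K := K) E x)).toAdd
    rw [map_pow, map_pow, toAdd_pow]
  have hlam_inv : ∀ x : absoluteGaloisGroup E, lam x⁻¹ = -lam x := fun x ↦ by
    show (κ (resGal (K := K) E x⁻¹)).toAdd = -(κ (resGal (K := K) E x)).toAdd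
    rw [map_inv, map_inv, toAdd_inv]
  have hmem : ∀ x : absoluteGaloisGroup E, x ∈ Hn ↔ (p : ℤ_[p]) ^ n ∣ lam x := fun x ↦ by
    rw [hHn, mem_localSubgroup_iff, ZpExtension.mem_layerSubgroup]
  by_cases htriv : ∀ x : absoluteGaloisGroup E, (p : ℤ_[p]) ^ n ∣ lam x
  · -- `H_{E,n} = Γ_E`
    refine ⟨1, 1, Nat.one_pos, one_dvd _, by rw [pow_one]; exact Hn.one_mem, fun τ ↦
      ⟨0, τ, Nat.one_pos, (hmem τ).mpr (htriv τ), by rw [pow_zero, one_mul]⟩⟩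
  · -- an element of minimal valuation `m < n`
    simp only [not_forall] at htriv
    obtain ⟨x₀, hx₀⟩ := htriv
    have hx₀0 : lam x₀ ≠ 0 := fun h ↦ hx₀ (by rw [h]; exact dvd_zero _)
    have hS : ∃ m : ℕ, ∃ x : absoluteGaloisGroup E, lam x ≠ 0 ∧ (lam x).valuation = m :=
      ⟨_, x₀, hx₀0, rfl⟩
    classical
    obtain ⟨σ₀, hσ0, hσv⟩ := Nat.find_spec hS
    have hmin : ∀ x : absoluteGaloisGroup E, lam x ≠ 0 → Nat.find hS ≤ (lam x).valuation :=
      fun x h ↦ Nat.find_min' hS ⟨x, h, rfl⟩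
    set m₀ := Nat.find hS with hm₀
    set u : ℤ_[p]ˣ := PadicInt.unitCoeff hσ0 with hu
    have hσeq : lam σ₀ = (u : ℤ_[p]) * (p : ℤ_[p]) ^ m₀ := by
      rw [← hσv]; exact PadicInt.unitCoeff_spec hσ0
    -- `m₀ < n` (else `x₀` would lie in the layer)
    have hm₀n : m₀ < n := by
      by_contra hle
      rw [not_lt] at hle
      apply hx₀
      have hv0 : m₀ ≤ (lam x₀).valuation := hmin x₀ hx₀0
      rw [PadicInt.unitCoeff_spec hx₀0]
      exact Dvd.dvd.mul_left (pow_dvd_pow _ (hle.trans hv0)) _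
    -- every `λ(x)` is divisible by `p^{m₀}`
    have hdiv : ∀ x : absoluteGaloisGroup E, ∃ z : ℤ_[p], lam x = (p : ℤ_[p]) ^ m₀ * z := by
      intro x
      by_cases h : lam x = 0
      · exact ⟨0, by rw [h, mul_zero]⟩
      · refine ⟨(PadicInt.unitCoeff h : ℤ_[p]) * (p : ℤ_[p]) ^ ((lam x).valuation - m₀), ?_⟩
        calc lam x = (PadicInt.unitCoeff h : ℤ_[p]) * (p : ℤ_[p]) ^ (lam x).valuation :=
              PadicInt.unitCoeff_spec h
          _ = (PadicInt.unitCoeff h : ℤ_[p]) *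
                ((p : ℤ_[p]) ^ m₀ * (p : ℤ_[p]) ^ ((lam x).valuation - m₀)) := by
              rw [← pow_add, Nat.add_sub_cancel' (hmin x h)]
          _ = (p : ℤ_[p]) ^ m₀ *
                ((PadicInt.unitCoeff h : ℤ_[p]) * (p : ℤ_[p]) ^ ((lam x).valuation - m₀)) := by
              ring
    refine ⟨σ₀, p ^ (n - m₀), pow_pos hp.out.pos _, pow_dvd_pow p (Nat.sub_le n m₀), ?_, fun τ ↦ ?_⟩
    · -- `σ₀^{p^{n-m₀}} ∈ H_{E,n}`
      rw [hmem, hlam_pow, hσeq, nsmul_eq_mul, Nat.cast_pow]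
      refine ⟨(u : ℤ_[p]), ?_⟩
      rw [show (p : ℤ_[p]) ^ n = (p : ℤ_[p]) ^ (n - m₀) * (p : ℤ_[p]) ^ m₀ by
        rw [← pow_add, Nat.sub_add_cancel hm₀n.le]]
      ring
    · -- the digit `a`
      obtain ⟨z, hz⟩ := hdiv τ
      let t : ℤ_[p] := z * ((u⁻¹ : ℤ_[p]ˣ) : ℤ_[p])
      refine ⟨t.appr (n - m₀), (σ₀ ^ t.appr (n - m₀))⁻¹ * τ, PadicInt.appr_lt _ _, ?_,
        by rw [mul_inv_cancel_left]⟩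
      rw [hmem, hlam_mul, hlam_inv, hlam_pow, hz, hσeq, nsmul_eq_mul]
      have happr := PadicInt.appr_spec (n - m₀) t
      rw [Ideal.mem_span_singleton] at happr
      obtain ⟨c, hc⟩ := happr
      have ht : z = t * (u : ℤ_[p]) := by
        show z = z * ((u⁻¹ : ℤ_[p]ˣ) : ℤ_[p]) * (u : ℤ_[p])
        rw [mul_assoc, Units.inv_mul, mul_one]
      refine ⟨c * (u : ℤ_[p]), ?_⟩
      rw [ht, show (p : ℤ_[p]) ^ n = (p : ℤ_[p]) ^ m₀ * (p : ℤ_[p]) ^ (n - m₀) by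
        rw [← pow_add, Nat.add_sub_cancel' hm₀n.le]]
      linear_combination ((p : ℤ_[p]) ^ m₀ * (u : ℤ_[p])) * hc

end Literature.NumberTheory.EllipticCurves

/-! ## §3 The bound on the fixed field of `H_{v,n}` -/

namespace IsDedekindDomain.HeightOneSpectrum

open Literature.NumberTheory.EllipticCurves Literature.NumberTheory.GaloisRepresentations Field

variable {K : Type u} [Field K] [NumberField K] {v : HeightOneSpectrum (𝓞 K)}
  {p : ℕ} [hp : Fact p.Prime] (hpv : (p : 𝓞 K) ∈ v.asIdeal)
  {w : Valuation (AlgebraicClosure (v.adicCompletion K)) ℝ≥0}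
  (hw : ∀ x, (w x : ℝ) = spectralNorm (v.adicCompletion K) (AlgebraicClosure (v.adicCompletion K)) x)

include hpv hw in
/-- **The valuation on the fixed field of `H_{v,n}` takes no value in `(|π|, 1)`.** Let `v ∣ p`
with `p` a uniformiser of `K_v` (`K_v/ℚ_p` unramified), `κ` a `ℤ_p`-extension of `K`, `n ≥ 0`, and
`π ∈ K̄_v` with `|π|^d = |p|` for some `d` with `pⁿ ∣ d`. Then every `x ∈ K̄_v` fixed by
`H_{v,n} = (Γ_{K_v} → Γ_K)⁻¹(κ⁻¹(pⁿℤ_p))` with `|x| < 1` has `|x| ≤ |π|`: by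
`ZpExtension.exists_generator_cosets_localSubgroup` and `spectralValuation_pow_le_of_forall_smul_eq`,
`|x|^N ≤ |p|` with `N ∣ pⁿ ∣ d`, so `|x|^d ≤ |x|^N ≤ |p| = |π|^d`. For the cyclotomic tower over `ℚ`
and `π` a uniformiser of `(ℚ_n)_p` this is the input `ρ = |π|` of `exists_kummerPoints_rank`.
[cite: NeukirchANT1999, Ch. II Prop. (7.5) with Prop. (9.11)] [cite: Washington1997, §13.1] -/
theorem spectralValuation_le_of_forall_mem_localSubgroup_smul_eq {𝔐 : Ideal (localAbsIntegers v)}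
    (h𝔐 : 𝔐 ∈ v.localPrimesAbove) (hϖ : Irreducible ((p : ℕ) : v.adicCompletionIntegers K))
    (κ : ZpExtension K p) (n : ℕ) {d : ℕ} (hdn : p ^ n ∣ d)
    {π : AlgebraicClosure (v.adicCompletion K)}
    (hπ : w π ^ d = w (p : AlgebraicClosure (v.adicCompletion K)))
    {x : AlgebraicClosure (v.adicCompletion K)}
    (hx : ∀ σ ∈ localSubgroup (κ.layerSubgroup n) (v.adicCompletion K), σ • x = x) (hx1 : w x < 1) :
    w x ≤ w π := by
  obtain ⟨σ₀, N, hN, hNdvd, hσN, hcos⟩ :=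
    ZpExtension.exists_generator_cosets_localSubgroup κ (v.adicCompletion K) n
  have hp1 : w (p : AlgebraicClosure (v.adicCompletion K)) < 1 := by
    have h := spectralValuation_algebraMap_ringOfIntegers_lt_one (v := v) hw hpv
    rwa [map_natCast] at h
  have hd : 0 < d := by
    refine Nat.pos_of_ne_zero fun h0 ↦ ?_
    rw [h0, pow_zero] at hπ
    exact absurd hp1 (not_lt.mpr hπ.le)
  have hNd : N ≤ d := Nat.le_of_dvd hd (hNdvd.trans hdn)
  have hpow : w x ^ N ≤ w (p : AlgebraicClosure (v.adicCompletion K)) :=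
    spectralValuation_pow_le_of_forall_smul_eq hw h𝔐 hϖ (localSubgroup (κ.layerSubgroup n)
      (v.adicCompletion K)) hN hσN (fun τ ↦ by
        obtain ⟨a, h, -, hh, he⟩ := hcos τ
        exact ⟨a, h, hh, he⟩) hx hx1
  have hxd : w x ^ d ≤ w π ^ d :=
    calc w x ^ d ≤ w x ^ N := pow_le_pow_of_le_one zero_le hx1.le hNd
      _ ≤ w (p : AlgebraicClosure (v.adicCompletion K)) := hpow
      _ = w π ^ d := hπ.symm
  exact le_of_pow_le_pow_left₀ hd.ne' zero_le hxd

end IsDedekindDomain.HeightOneSpectrum
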